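import Mathlib.Probability.ProbabilityMassFunction.Constructions
import Mathlib.Data.Set.BoolIndicator
import Literature.Computability.Cryptography.SamplingProblems
import Literature.Computability.Cryptography.SamplingProblemsIQPProofs
import Literature.Computability.Cryptography.EncryptionSchemes
import Literature.Computability.Complexity.OracleProofs
import Literature.Computability.Complexity.ProbabilisticClassesProofs
import HarnessLib

/-!
# `BPPSampIQP`: bounded-error classical polynomial time with a stateless `{Z, CZ, T}`-IQP sampler

The decision class `BPPSampIQP`: the FIXED-GATE-SET instance — diagonal parts over the tree's IQP
gate set `iqpDiag = {Z, CZ, T}` — of Shepherd–Bremner's `BPP^{IQP}` and Buzet–Chailloux's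
`BPP^IQP`: languages decided with error `≤ 1/3` by a randomised polynomial-time *classical* oracle
machine whose oracle, on input the description of an IQP circuit `C = H^{⊗N} D H^{⊗N}` with `D` a
circuit over `{Z, CZ, T}`, returns ONE fresh sample `y ∈ {0,1}^N` of the output distribution
`Pr[y] = |⟨y| H^{⊗N} D H^{⊗N} |0^N⟩|²`; nothing quantum survives between calls, repeated calls are
answered independently, and the calls may be adaptive. **The printed classes are wider a priori**:
the sources' IQP oracle accepts ANY gate-by-gate described diagonal unitary `D` (Buzet–Chailloux
Def. 2: "D is a unitary diagonal in the computational basis"; Shepherd–Bremner's X-programs have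
terms `(θ_p, p)` of arbitrary angle and weight, e.g. `X₁X₃X₄`; Bremner–Jozsa–Shepherd give gates by
their diagonal entries), whereas over `{Z, CZ, T}` the phase polynomial has no cubic terms and
quadratic coefficients in `πℤ` (no `exp(iπ/8 Z⊗Z)`, no `CCZ`). So `BPPSampIQP` is a priori a
SUBCLASS of the printed `BPP^IQP`; equality of the two classes is NOT asserted anywhere in this
file, and no statement printed about `BPP^IQP` may be attached to `BPPSampIQP` without checking the
gate set. Every `[cite: BuzetChailloux2026, …]` below is to be read "specialised to the gate set
`iqpDiag`".

* Shepherd–Bremner 2009, §2.2, Definition 1 (arXiv numbering): "On input the explicit description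
  of an X-program, we define an IQP oracle to be any computational method that efficiently returns
  a sample string from the probability distribution … let it be any device that interfaces to a
  probabilistic Turing machine via an 'oracle tape' …. We write the overall paradigm — of classical
  computation augmented by this oracle — as `BPP^IQP`."
* Buzet–Chailloux 2026, §2.4 (p. 12): Definition 2 (IQP circuit `C = H^{⊗m} D H^{⊗m}`, "a
  description of `C` is a string `w` specifying `m` and the type, number, and positions of the
  gates comprising `D`"), Definition 3 (the IQP oracle `O_IQP`: input `w`, output a single sample
  `y ∈ {0,1}^m` with `Pr[y | w] = |⟨y|H^{⊗m} D_w H^{⊗m}|0^m⟩|²`), Definition 4 (`L ∈ BPP^IQP` iff some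
  randomised polynomial-time classical `A` with access to `O_IQP` has `Pr[A^{O_IQP}(x) = 1] ≥ 2/3`
  for `x ∈ L` and `≤ 1/3` otherwise, "the probability is over the internal randomness of `A` and the
  responses of `O_IQP`"); §4 Remark 2 (all their calls are non-adaptive), Remark 3
  (`BPP^IQP ⊆ BQP`).

## Contents

* `IQPDesc = Σ N, QCircuit iqpDiag N` (descriptions of `{Z, CZ, T}`-IQP circuits) and its query
  code `IQPDesc.encode ⟨N, D⟩ = ⟨1^N, code D⟩` (`encode_injective`, `wires_le_length_encode`);
* `iqpOutputPMF D` — the Born law of `H^{⊗N} U_D H^{⊗N} |0^N⟩` on `QReg N` (`iqpOutputPMF_apply`: it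
  IS `y ↦ |⟨y|H D H|0^N⟩|²`, no renormalisation, by `iqpUnitary_mem_unitaryGroup_holds`);
* `iqpSampler : SamplingProblem` — the `{Z, CZ, T}`-IQP sampler (fixed-gate-set instance of the
  IQP oracle) as a probabilistic, stateless oracle (`iqpSampler_encode`, `iqpSampler_of_forall_ne`,
  `length_le_of_mem_support_iqpSampler`: answers are never longer than queries);
* `HasPolyQueries M`, `probAccept 𝒜 O x`, the generic class `BPPSamp O` of languages decided by
  bounded-error randomised polynomial-time machines with access to the sampling oracle `O`, and
  `BPPSampIQP := BPPSamp iqpSampler`;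
* proved API: `mem_BPPSampIQP_iff`, `probAccept_ofFun`, `BPP_subset_BPPSamp`,
  `BPP_subset_BPPSampIQP`, `P_subset_BPPSampIQP`.

## Design choices

* **Machine.** A randomised polynomial-time classical oracle algorithm is the tree's
  `OracleAdversary Bool` (`OracleGames.lean`: a transcript-style `OracleAlg Bool` reading its coins
  from the second `boolPair` component of its input, with polynomial coin and round budgets), run
  against a *probabilistic* oracle by `OracleAdversary.probOutputPMF` (`EncryptionSchemes.lean`:
  uniform coins, then `OracleAlg.probRun`, which answers every query by a FRESH sample — this is the
  statelessness / independence of the IQP oracle). Polynomial time is `OracleAdversary.IsPPT` (the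
  step function is polynomial-time in the transcript) **plus** `HasPolyQueries` (every query the
  step function can emit on input `w` has length `≤ q |w|`), the analogue of clause (ii) of
  `Literature.Computability.Complexity.PRel` (`Oracle.lean`, "Resource bounds, adequacy and
  caveat"): since the sampler's answers are never longer than its queries
  (`length_le_of_mem_support_iqpSampler`), the whole transcript has polynomial length, so the model
  is the textbook probabilistic polynomial-time oracle Turing machine with a unit-cost oracle tape.
  Without the clause the transcript model would allow iterated-polynomial growth of the queries.
  `HasPolyQueries` is imposed at every transcript (reachable or not); a machine can always be
  disciplined to satisfy it without changing its reachable behaviour.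
* **Query format.** A query is `IQPDesc.encode ⟨N, D⟩ = boolPair (1^N) (QCircuit.encode D)`: the
  number of wires in UNARY followed by the gate list (gate symbol and wire positions,
  `QGate.encode`), exactly "a string specifying `m` and the type, number, and positions of the
  gates" (Buzet–Chailloux Def. 2); Shepherd–Bremner's X-program is a `poly(n) × n` matrix, whose
  description is likewise at least as long as the number of qubits. The unary wire count makes the
  oracle *polynomially bounded* (an `N`-bit answer to a query of length `≥ N`); with a binary wire
  count a short query could command exponentially many idle wires and an exponentially long answer
  (compare the unary ancilla count of `QCircuit.sigmaEncode`). Ill-formed queries are answered by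
  the empty string (Dirac mass at `[]`; documented junk value, useless to the machine).
* **Gate set (the specialisation).** The diagonal part ranges over the tree's IQP gate set
  `iqpDiag = {Z, CZ, T}` (`SamplingProblems.lean`; Bremner–Jozsa–Shepherd 2011 §2.3, `Z`-basis form
  `H … H`), as requested by route `QuantumAdvantage/CommutingDeciders`; the sources' oracle accepts
  any described diagonal `D` (see the header). Whether the decision class depends on the diagonal
  gate set is not known and not asserted here either way; a gate-set-parametrised sampler is not
  provided (`iqpUnitary` is stated for `iqpDiag` only).
* **Oracle gates are inert.** The tree's circuit syntax `QCircuit iqpDiag N` also admits the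
  oracle-query gates `QGate.oracle k e`; `iqpUnitary` reads the diagonal part through the
  oracle-free semantics `QCircuit.mat = QCircuit.toMatrix 0`, under which such a gate is
  `oracleGate 0 k = 1` (the answer wire is XORed with the indicator of the empty language). So a
  description containing oracle gates denotes the same circuit with those gates deleted —
  a documented, harmless redundancy of the query format (no extra distributions, no extra power).
* **Acceptance.** `probAccept` is the mass of `some true`; runs that do not halt within the round
  budget (`none`) count as rejection (a clocked machine always halts). The `2/3`–`1/3` gap is
  required on every input (Buzet–Chailloux Def. 4).
* **Coins.** Internal coins are the `coins` budget of the `OracleAdversary`; they could also be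
  drawn from the oracle (the one-wire circuit `T·T = S` gives `|⟨1|H S H|0⟩|² = 1/2`), which is why
  Shepherd–Bremner do not separate the two sources of randomness.
* `BPPSamp O` is stated for an arbitrary sampling oracle `O : SamplingProblem`; for a Dirac oracle
  `pure ∘ O'` it is the machine form of `BPPRel O' = bp (PRel O')` (same class by the usual
  coins-as-input argument; not restated or proved here).

## What is deliberately NOT here

* The printed, any-diagonal-gate `BPP^IQP` (it would need a query format for general described
  diagonal unitaries, e.g. X-programs with dyadic angles) and any comparison of it with
  `BPPSampIQP` beyond the a-priori inclusion discussed in the header.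
* `BPPSampIQP ⊆ BQP` (Buzet–Chailloux Remark 3 for their class: "IQP is weaker than BQP and
  `BPP^BQP = BQP`") and the embedding of the one-shot commuting deciders of route
  `CommutingDeciders` (one non-adaptive query) are left to route / fact items; no unproved named
  fact is introduced by this file.

## References

* D. Shepherd, M. J. Bremner, *Temporally unstructured quantum computation*, Proc. R. Soc. A 465
  (2009) 1413–1439, arXiv:0809.0847, §2.1–§2.2, Def. 1. [ShepherdBremner2009]
* Q. Buzet, A. Chailloux, *IQP circuits for 2-Forrelation*, arXiv:2604.15248 (2026), §2.4
  Defs. 2–4 (p. 12), §4 Remarks 2–3 (p. 20). [BuzetChailloux2026]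
* M. J. Bremner, R. Jozsa, D. J. Shepherd, Proc. R. Soc. A 467 (2011), §2.3 Def. 2.
  [BremnerJozsaShepherd2011]
* S. Arora, B. Barak, *Computational Complexity*, CUP 2009, §3.4 and Def. 7.1 (probabilistic
  oracle machines). [AroraBarak2009]
-/

noncomputable section

namespace Literature.Computability.QuantumComplexity

open _root_.Computability _root_.Matrix Literature.Computability.Complexity
  Literature.Computability.Cryptography

/-! ### Descriptions of IQP circuits: the queries -/

/-- A description of a `{Z, CZ, T}`-IQP circuit: a number of wires `N` and the diagonal part
`D : QCircuit iqpDiag N` (a gate list over the tree's gate set `iqpDiag = {Z, CZ, T}` with wire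
positions); the circuit is `H^{⊗N} U_D H^{⊗N}` run on `|0^N⟩` with all `N` wires measured. This is
the fixed-gate-set instance of Buzet–Chailloux's descriptions (their `D` is any gate-by-gate
described diagonal unitary; equality of the resulting classes is not asserted). The circuit syntax
also admits oracle-query gates `QGate.oracle k e`, which act as the IDENTITY under the oracle-free
semantics `QCircuit.mat = toMatrix 0` used by `iqpUnitary` (documented redundancy: such a
description denotes the circuit with those gates deleted).
[cite: BuzetChailloux2026, §2.4 Def. 2 (p. 12), specialised to the gate set iqpDiag] -/
abbrev IQPDesc : Type := Σ N : ℕ, QCircuit iqpDiag N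

namespace IQPDesc

/-- The query code of an IQP circuit description, "a string specifying `m` and the type, number,
and positions of the gates comprising `D`": the wire count in unary, then the gate list,
`encode ⟨N, D⟩ = boolPair (1^N) (QCircuit.encode D)`. The unary wire count makes every answer of
the IQP oracle (an `N`-bit string) at most as long as its query (`wires_le_length_encode`).
[cite: BuzetChailloux2026, §2.4 Def. 2 (p. 12), specialised to the gate set iqpDiag] -/
def encode (c : IQPDesc) : List Bool :=
  boolPair (unaryEncodeNat c.1) (QCircuit.encode c.2)

/-- **The query code is injective** (`boolPair`, the unary code and `QCircuit.encode` are).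
[folklore] -/
theorem encode_injective : Function.Injective encode := by
  rintro ⟨N, D⟩ ⟨N', D'⟩ h
  obtain ⟨h1, h2⟩ := QCircuit.boolPair_inj h
  obtain rfl : N = N' := QCircuit.unaryEncodeNat_injective h1
  obtain rfl : D = D' := QCircuit.encode_injective h2
  rfl

/-- The length of a query: `|encode ⟨N, D⟩| = 2N + 2 + |code D|` (`|1^N| = N` is Mathlib's
`unary_decode_encode_nat`). [folklore] -/
theorem length_encode (c : IQPDesc) :
    (encode c).length = 2 * c.1 + 2 + (QCircuit.encode c.2).length := by
  have h : (unaryEncodeNat c.1).length = c.1 := unary_decode_encode_nat c.1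
  rw [encode, length_boolPair, h]

/-- A description is at least as long as its number of wires (the wire count is unary).
[cite: BuzetChailloux2026, §2.4 Def. 2 (p. 12), specialised to the gate set iqpDiag] -/
theorem wires_le_length_encode (c : IQPDesc) : c.1 ≤ (encode c).length := by
  rw [length_encode]; omega

end IQPDesc

/-! ### The output law of a `{Z, CZ, T}`-IQP circuit and the sampler -/

/-- The output distribution of the `{Z, CZ, T}`-IQP circuit with diagonal part `D` on `N` wires:
the Born law (`bornPMF`) of the state `H^{⊗N} U_D H^{⊗N} |0^N⟩` (`iqpUnitary D *ᵥ basisState 0`),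
all wires measured. [cite: BuzetChailloux2026, §2.4 Def. 3 (p. 12), specialised to the gate set iqpDiag] -/
def iqpOutputPMF {N : ℕ} (D : QCircuit iqpDiag N) : PMF (QReg N) :=
  bornPMF (iqpUnitary D *ᵥ basisState (fun _ => false))

/-- **`Pr[y | w] = |⟨y| H^{⊗N} D_w H^{⊗N} |0^N⟩|²`**: the output law assigns to `y` exactly the squared
amplitude (the IQP unitary is unitary, `iqpUnitary_mem_unitaryGroup_holds`, so the output state is
a unit vector and `bornPMF` does not renormalise).
[cite: BuzetChailloux2026, §2.4 Def. 3 (p. 12), specialised to the gate set iqpDiag] -/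
theorem iqpOutputPMF_apply {N : ℕ} (D : QCircuit iqpDiag N) (y : QReg N) :
    iqpOutputPMF D y = ENNReal.ofReal (‖(iqpUnitary D *ᵥ basisState (fun _ => false)) y‖ ^ 2) := by
  have h := normSq_mulVec_of_mem_unitaryGroup (iqpUnitary_mem_unitaryGroup_holds D)
    (basisState (fun _ : Fin N => false))
  rw [normSq_basisState, normSq] at h
  exact bornPMF_apply_of_sum_eq_one h y

/-- **The `{Z, CZ, T}`-IQP sampler** — the fixed-gate-set instance of the IQP oracle `O_IQP` — as a
probabilistic, stateless oracle (a `SamplingProblem`): the query `encode ⟨N, D⟩`,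
`D : QCircuit iqpDiag N`, is answered by ONE fresh sample `List.ofFn y`, `y ~ iqpOutputPMF D` (all
`N` wires measured); ill-formed queries are answered by the empty string (Dirac mass at `[]`,
documented junk value); oracle-query gates inside `D` act as the identity (see `IQPDesc`).
Shepherd–Bremner: "any device that interfaces to a probabilistic Turing machine via an 'oracle
tape', so that if the oracle tape holds a description of a particular X-program … a bitstring
sample … from the probability distribution … is created and written to the oracle tape". The
sources' oracle accepts any described diagonal `D` (X-programs of arbitrary angles and weights;
Buzet–Chailloux Def. 2–3); this one only `{Z, CZ, T}` circuits, and no equality of the induced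
classes is asserted. [cite: BuzetChailloux2026, §2.4 Def. 3 (p. 12), specialised to the gate set iqpDiag] -/
def iqpSampler : SamplingProblem := fun q =>
  open scoped Classical in
  if h : ∃ c : IQPDesc, c.encode = q then (iqpOutputPMF h.choose.2).map List.ofFn else PMF.pure []

/-- The sampler on a well-formed query samples the described circuit.
[cite: BuzetChailloux2026, §2.4 Def. 3 (p. 12), specialised to the gate set iqpDiag] -/
theorem iqpSampler_encode (c : IQPDesc) :
    iqpSampler c.encode = (iqpOutputPMF c.2).map List.ofFn := by
  have h : ∃ c' : IQPDesc, c'.encode = c.encode := ⟨c, rfl⟩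
  unfold iqpSampler
  rw [dif_pos h]
  have key : ∀ c' : IQPDesc, c' = c →
      (iqpOutputPMF c'.2).map List.ofFn = (iqpOutputPMF c.2).map List.ofFn := by
    rintro _ rfl; rfl
  exact key _ (IQPDesc.encode_injective h.choose_spec)

/-- The sampler answers ill-formed queries by the empty string (junk value). [folklore] -/
theorem iqpSampler_of_forall_ne {q : List Bool} (h : ∀ c : IQPDesc, c.encode ≠ q) :
    iqpSampler q = PMF.pure [] := by
  unfold iqpSampler
  rw [dif_neg (fun ⟨c, hc⟩ => h c hc)]

/-- Every answer to the query `encode ⟨N, D⟩` is an `N`-bit string.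
[cite: BuzetChailloux2026, §2.4 Def. 3 (p. 12), specialised to the gate set iqpDiag] -/
theorem length_eq_of_mem_support_iqpSampler_encode {c : IQPDesc} {a : List Bool}
    (ha : a ∈ (iqpSampler c.encode).support) : a.length = c.1 := by
  rw [iqpSampler_encode, PMF.support_map] at ha
  obtain ⟨y, -, rfl⟩ := ha
  rw [List.length_ofFn]

/-- **The sampler is polynomially bounded**: an answer is never longer than its query (the wire
count is written in unary), so transcripts of machines with polynomially bounded queries have
polynomial length. [folklore] -/
theorem length_le_of_mem_support_iqpSampler {q a : List Bool} (ha : a ∈ (iqpSampler q).support) :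
    a.length ≤ q.length := by
  by_cases h : ∃ c : IQPDesc, c.encode = q
  · obtain ⟨c, rfl⟩ := h
    rw [length_eq_of_mem_support_iqpSampler_encode ha]
    exact c.wires_le_length_encode
  · rw [iqpSampler_of_forall_ne (fun c hc => h ⟨c, hc⟩), PMF.support_pure,
      Set.mem_singleton_iff] at ha
    rw [ha]
    exact Nat.zero_le _

/-! ### Randomised polynomial-time machines with a sampling oracle -/

/-- `HasPolyQueries M`: the queries of the transcript algorithm `M` are polynomially bounded — for
some polynomial `q`, at every input `w` and every transcript of answers, the query emitted (if any)
has length `≤ q |w|`. This is clause (ii) of `Literature.Computability.Complexity.PRel` imposed at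
every transcript; with a polynomially bounded oracle it keeps the transcript, hence the running
time, polynomial. [cite: AroraBarak2009, §3.4 (oracle machines run in polynomial time)] -/
def HasPolyQueries {β : Type} (M : OracleAlg β) : Prop :=
  ∃ q : Polynomial ℕ, ∀ (w : List Bool) (as : List (List Bool)) (u : List Bool),
    M.step w as = Sum.inl u → u.length ≤ q.eval w.length

/-- A query-free algorithm has (vacuously) polynomially bounded queries. [folklore] -/
theorem hasPolyQueries_ofFun {β : Type} (f : List Bool → β) : HasPolyQueries (OracleAlg.ofFun f) :=
  ⟨0, fun w as u h => by simp [OracleAlg.ofFun] at h⟩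

/-- `probAccept 𝒜 O x = Pr[𝒜^O(x) = 1]`: the probability that the randomised oracle machine `𝒜`
accepts `x` when run against the sampling oracle `O` — uniform coins `r ∈ {0,1}^{coins |x|}`, then
`fuel |x|` rounds of `𝒜.alg` on `boolPair x r`, each query answered by a fresh sample of `O`
(`OracleAdversary.probOutputPMF`); the mass of the output `some true`.
[cite: BuzetChailloux2026, §2.4 Def. 4 (p. 12) ("the probability is over the internal randomness of A and the responses")] -/
def probAccept (𝒜 : OracleAdversary Bool) (O : SamplingProblem) (x : List Bool) : ℝ :=
  (𝒜.probOutputPMF O x (some true)).toReal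

/-- Acceptance probabilities are nonnegative. [folklore] -/
theorem probAccept_nonneg (𝒜 : OracleAdversary Bool) (O : SamplingProblem) (x : List Bool) :
    0 ≤ probAccept 𝒜 O x :=
  ENNReal.toReal_nonneg

/-- Acceptance probabilities are at most `1`. [folklore] -/
theorem probAccept_le_one (𝒜 : OracleAdversary Bool) (O : SamplingProblem) (x : List Bool) :
    probAccept 𝒜 O x ≤ 1 :=
  ENNReal.toReal_le_of_le_ofReal zero_le_one (by simpa using PMF.coe_le_one _ _)

/-- A query-free algorithm halts at once against any sampling oracle: within a positive round
budget its output law is the Dirac mass at `some (f w)`. [folklore] -/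
theorem probRun_ofFun_succ {β : Type} (f : List Bool → β) (O : SamplingProblem) (k : ℕ)
    (w : List Bool) : (OracleAlg.ofFun f).probRun O (k + 1) w = PMF.pure (some (f w)) :=
  rfl

/-- `probRun_ofFun_succ` with the literal budget `1`. [folklore] -/
theorem probRun_ofFun_one {β : Type} (f : List Bool → β) (O : SamplingProblem) (w : List Bool) :
    (OracleAlg.ofFun f).probRun O 1 w = PMF.pure (some (f w)) :=
  probRun_ofFun_succ f O 0 w

/-- **Acceptance probability of a query-free machine**: the machine `⟨ofFun f, c, 1⟩` accepts `x`
with the counting probability, over coins `r ∈ {0,1}^{c |x|}`, that `f ⟨x, r⟩ = true` — whatever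
the oracle. [cite: AroraBarak2009, Def. 7.1 (probabilistic machines as deterministic ones with a random tape)] -/
theorem probAccept_ofFun (f : List Bool → Bool) (c : Polynomial ℕ) (O : SamplingProblem)
    (x : List Bool) :
    probAccept ⟨OracleAlg.ofFun f, c, 1⟩ O x =
      uniformProb (c.eval x.length) {y | f (boolPair x y) = true} := by
  unfold probAccept OracleAdversary.probOutputPMF
  simp only [Polynomial.eval_one, probRun_ofFun_one]
  change ((PMF.uniformOfFintype (List.Vector Bool (c.eval x.length))).map
    (fun r => some (f (boolPair x r.toList))) (some true)).toReal = _
  rw [← PMF.toOuterMeasure_apply_singleton, PMF.toOuterMeasure_map_apply,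
    uniformProb_eq_toOuterMeasure]
  have hS : (fun r : List.Vector Bool (c.eval x.length) => some (f (boolPair x r.toList))) ⁻¹'
      {some true} = {r | r.toList ∈ {y | f (boolPair x y) = true}} := by
    ext r; simp
  rw [hS]

/-! ### The classes `BPPSamp O` and `BPPSampIQP` -/

/-- `BPPSamp O`: the languages decided with two-sided error `≤ 1/3` by a randomised polynomial-time
classical machine with access to the (probabilistic, stateless) sampling oracle `O` — some
`𝒜 : OracleAdversary Bool` with polynomial-time step function (`IsPPT`), polynomially bounded
queries (`HasPolyQueries`) and, on every input `x`, `Pr[𝒜^O(x) = 1] ≥ 2/3` if `x ∈ L` and `≤ 1/3`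
if `x ∉ L`, the probability being over `𝒜`'s coins and the oracle's samples (`probAccept`). With
`O = iqpSampler` this is `BPPSampIQP`; Buzet–Chailloux's Definition 4 is the case of their (wider,
any-diagonal-gate) IQP oracle. [cite: BuzetChailloux2026, §2.4 Def. 4 (p. 12) (the machine model, for a general sampling oracle O)] -/
def BPPSamp (O : SamplingProblem) : Set (Language Bool) :=
  {L | ∃ 𝒜 : OracleAdversary Bool, 𝒜.IsPPT encodingBoolBool ∧ HasPolyQueries 𝒜.alg ∧
    ∀ x : List Bool, (x ∈ L → (2 / 3 : ℝ) ≤ probAccept 𝒜 O x) ∧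
      (x ∉ L → probAccept 𝒜 O x ≤ (1 / 3 : ℝ))}

/-- **`BPPSampIQP`** — the fixed-gate-set (`iqpDiag = {Z, CZ, T}`) instance of Shepherd–Bremner's
`BPP^{IQP}` ("classical randomised polytime pre- and post-processing" around the IQP oracle) and of
Buzet–Chailloux's `BPP^IQP` (Definition 4): bounded-error randomised classical polynomial time with
access to the sampler `iqpSampler` — each call hands over the description `⟨1^N, code D⟩` of an
IQP circuit with `D` over `{Z, CZ, T}` and receives one fresh sample of `H^{⊗N} U_D H^{⊗N} |0^N⟩`
measured on all wires; calls may be adaptive, nothing quantum persists between calls. The printed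
classes allow ANY described diagonal `D` in a query, so `BPPSampIQP` is a priori a subclass of the
printed `BPP^IQP`; equality of the classes is NOT asserted (and not known).
[cite: BuzetChailloux2026, §2.4 Def. 4 (p. 12), specialised to the gate set iqpDiag] -/
def BPPSampIQP : Set (Language Bool) :=
  BPPSamp iqpSampler

/-- Unfolding lemma for `BPPSamp`. [cite: BuzetChailloux2026, §2.4 Def. 4 (p. 12) (the machine model, for a general sampling oracle O)] -/
theorem mem_BPPSamp_iff {O : SamplingProblem} {L : Language Bool} :
    L ∈ BPPSamp O ↔ ∃ 𝒜 : OracleAdversary Bool, 𝒜.IsPPT encodingBoolBool ∧ HasPolyQueries 𝒜.alg ∧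
      ∀ x : List Bool, (x ∈ L → (2 / 3 : ℝ) ≤ probAccept 𝒜 O x) ∧
        (x ∉ L → probAccept 𝒜 O x ≤ (1 / 3 : ℝ)) :=
  Iff.rfl

/-- Unfolding lemma for `BPPSampIQP = BPPSamp iqpSampler`.
[cite: BuzetChailloux2026, §2.4 Def. 4 (p. 12), specialised to the gate set iqpDiag] -/
theorem mem_BPPSampIQP_iff {L : Language Bool} :
    L ∈ BPPSampIQP ↔ ∃ 𝒜 : OracleAdversary Bool, 𝒜.IsPPT encodingBoolBool ∧ HasPolyQueries 𝒜.alg ∧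
      ∀ x : List Bool, (x ∈ L → (2 / 3 : ℝ) ≤ probAccept 𝒜 iqpSampler x) ∧
        (x ∉ L → probAccept 𝒜 iqpSampler x ≤ (1 / 3 : ℝ)) :=
  Iff.rfl

/-- **`BPP ⊆ BPPSamp O` for every sampling oracle**: a `BPP` language `L` with witness `L' ∈ P`
and coin polynomial `p` (`BPP = bp P`) is decided by the query-free machine `⟨ofFun [· ∈ L'], p, 1⟩`,
whose acceptance probability is the counting probability of `{y | ⟨x, y⟩ ∈ L'}`
(`probAccept_ofFun`), `≥ 2/3` on `x ∈ L` and `≤ 1/3` on `x ∉ L` (complement rule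
`uniformProb_compl`). [cite: BennettGill1981, §1 (P^O ⊆ BPP^O; ignoring the oracle)] -/
theorem BPP_subset_BPPSamp (O : SamplingProblem) : BPP ⊆ BPPSamp O := by
  rintro L ⟨L', hL', p, hp⟩
  refine ⟨⟨OracleAlg.ofFun L'.boolIndicator, p, 1⟩, ?_, hasPolyQueries_ofFun _, fun x => ?_⟩
  · exact OracleAlg.isPolyTime_ofFun_holds (polyTimeDecidable_iff.1 (mem_P_iff_holds.1 hL'))
  · have hx := hp x
    rw [probAccept_ofFun]
    have hE : {y : List Bool | L'.boolIndicator (boolPair x y) = true} = {y | boolPair x y ∈ L'} := by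
      ext y; exact (L'.mem_iff_boolIndicator _).symm
    rw [hE]
    constructor
    · intro hxL
      have hE' : {y : List Bool | boolPair x y ∈ L' ↔ x ∈ L} = {y | boolPair x y ∈ L'} := by
        ext y; simp only [Set.mem_setOf_eq]; exact iff_true_right hxL
      rw [hE'] at hx
      exact hx
    · intro hxL
      have hE' : {y : List Bool | boolPair x y ∈ L' ↔ x ∈ L} = {y | boolPair x y ∈ L'}ᶜ := by
        ext y; simp only [Set.mem_setOf_eq, Set.mem_compl_iff]; exact iff_false_right hxL
      rw [hE', uniformProb_compl] at hx
      linarith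

/-- **`BPP ⊆ BPPSampIQP`** (ignore the oracle). [cite: BennettGill1981, §1 (P^O ⊆ BPP^O)] -/
theorem BPP_subset_BPPSampIQP : BPP ⊆ BPPSampIQP :=
  BPP_subset_BPPSamp iqpSampler

/-- **`P ⊆ BPPSampIQP`** (`P ⊆ BPP`, `P_subset_BPP_holds`, then `BPP_subset_BPPSampIQP`).
[cite: BennettGill1981, §1 (P^O ⊆ BPP^O)] -/
theorem P_subset_BPPSampIQP : Classes.P ⊆ BPPSampIQP :=
  fun _ hL => BPP_subset_BPPSampIQP (P_subset_BPP_holds hL)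

end Literature.Computability.QuantumComplexity

end
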